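import Literature.NumberTheory.EllipticCurves.HidaFamilyGaloisRepDatum
import HarnessLib

set_option autoImplicit false

/-!
# The `ℚ_p`-rational weight-two point of a Hida datum — DEFINITIONS
# (helper vocabulary for crux stmt-BirchSwinnertonDyer-20547 `KatoDivisibilityX9`, line `prime_adapted_tau`, stub 3)

For a Hida datum `D : HidaFamilyGaloisRepDatum W p 𝕀` (tree) the point of `W` is the ring homomorphism
`D.specW : 𝕀 →+* ℚ̄_p` of field (v).  This file holds the vocabulary of the hypothesis

* (W2ℚ_p) `D.WeightTwoRational` — the weight-two point is `ℚ_p`-RATIONAL: `specW(𝕀) ⊂ ℚ_p` (then `⊂ ℤ_p` by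
  `norm_specW_le_one`).  A theorem for `𝕀 = Λ` and for every Hecke-generated branch through the rational newform of
  `W`; an assumption for an abstract datum (base changes to ramified `𝒪⟦X⟧` are data);

together with the embedding `iotaZp : ℤ_p →+* ℚ̄_p` (`iotaZp_apply`, `norm_iotaZp`, `iotaZp_injective`),
`exists_specW_eq_iotaZp` (under (W2ℚ_p) the point takes values in `ℤ_p`) and the `ℤ_p`-valued co-restriction
`D.specWZp hW2 : 𝕀 →+* ℤ_p` (`iotaZp_specWZp`, `ker_specWZp` — same kernel `P_W`, `specWZp_algebraMap_C` — it
retracts the constants of `Λ`).  Verbatim from the bsd-f3-mu cell's kernel-checked sketches `Sketch71.lean` v5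
f376123484d02b28 §B/§E (planner-bsd-f3-mu-desc g71) and `Sketch74.lean` bf97a731e7ef97ad §2 (desc g74); port plan
PORT-PLAN-72 (desc g72).  (W2ℚ_p) is the hypothesis of the weight-two test `…ULedgerWeightTwoTest.lean` and of the
collapse theorem «(Car_W) ∧ (W2ℚ_p) ⟹ (Reg)» `…ULedgerCollapse.lean`.  No ledger item is closed here; BSD is proved
for no curve.  Reference for the datum: [Ochiai2006] §3; [Hida1986].
-/

noncomputable section

namespace Literature.NumberTheory.EllipticCurves.HidaFamilyGaloisRepDatum

open Literature.NumberTheory.EllipticCurves Literature.NumberTheory.GaloisRepresentations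

variable {W : WeierstrassCurve ℚ} {p : ℕ} [Fact p.Prime] {I : Type} [CommRing I] [IsDomain I]
  [IsLocalRing I] [TopologicalSpace I] [IsTopologicalRing I] [Algebra (IwasawaAlgebra p) I]
  (D : HidaFamilyGaloisRepDatum W p I)

/-- **(W2ℚ_p) — the weight-two point of the datum is `ℚ_p`-rational**: `specW(𝕀) ⊂ ℚ_p` (then `= ℤ_p` by
`norm_specW_le_one`).  A THEOREM for `𝕀 = Λ` (`specW_algebraMap`), and free for every Hecke-generated branch through
the rational newform of `W` (`specW` of a Frobenius trace is `a_ℓ(W) ∈ ℤ` by clause (v)); an assumption for an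
abstract datum (base changes to ramified `𝒪⟦X⟧` are data). Hypothesis of the weight-2 test, Lemma 71.3. -/
def WeightTwoRational : Prop :=
  ∀ x : I, ∃ q : ℚ_[p], D.specW x = algebraMap ℚ_[p] (PadicAlgCl p) q

/-- `ℤ_p → ℚ̄_p`. -/
def iotaZp (p : ℕ) [Fact p.Prime] : ℤ_[p] →+* PadicAlgCl p :=
  (algebraMap ℚ_[p] (PadicAlgCl p)).comp PadicInt.Coe.ringHom

omit [IsDomain I] [IsLocalRing I] [TopologicalSpace I] [IsTopologicalRing I] [Algebra (IwasawaAlgebra p) I] in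
/-- `iotaZp z` is the image of `z` under `ℚ_p → ℚ̄_p`. -/
theorem iotaZp_apply (z : ℤ_[p]) : iotaZp p z = algebraMap ℚ_[p] (PadicAlgCl p) (z : ℚ_[p]) := rfl

omit [IsDomain I] [IsLocalRing I] [TopologicalSpace I] [IsTopologicalRing I] [Algebra (IwasawaAlgebra p) I] in
/-- `iotaZp` is norm-preserving. -/
theorem norm_iotaZp (z : ℤ_[p]) : ‖iotaZp p z‖ = ‖z‖ := by
  rw [iotaZp_apply, norm_algebraMap', PadicInt.norm_def]

omit [IsDomain I] [IsLocalRing I] [TopologicalSpace I] [IsTopologicalRing I] [Algebra (IwasawaAlgebra p) I] in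
/-- `iotaZp` is injective. -/
theorem iotaZp_injective : Function.Injective (iotaZp p) := fun _ _ h =>
  PadicInt.ext ((algebraMap ℚ_[p] (PadicAlgCl p)).injective h)

/-- Under (W2ℚ_p) the point of `W` takes values in `ℤ_p`. -/
theorem exists_specW_eq_iotaZp (hW2 : D.WeightTwoRational) (x : I) : ∃ z : ℤ_[p], D.specW x = iotaZp p z := by
  obtain ⟨q, hq⟩ := hW2 x
  have hq1 : ‖q‖ ≤ 1 := by
    have := D.norm_specW_le_one x
    rwa [hq, norm_algebraMap'] at this
  exact ⟨⟨q, hq1⟩, by rw [hq]; rfl⟩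

/-- **The `ℤ_p`-valued co-restriction of the point of `W`** under (W2ℚ_p): `specWZp : 𝕀 →+* ℤ_p` with
`iotaZp ∘ specWZp = specW`. -/
def specWZp (hW2 : D.WeightTwoRational) : I →+* ℤ_[p] where
  toFun x := Classical.choose (D.exists_specW_eq_iotaZp hW2 x)
  map_one' := iotaZp_injective (p := p) (by
    rw [← Classical.choose_spec (D.exists_specW_eq_iotaZp hW2 1), map_one, map_one])
  map_mul' x y := iotaZp_injective (p := p) (by
    rw [← Classical.choose_spec (D.exists_specW_eq_iotaZp hW2 (x * y)), map_mul, map_mul,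
      ← Classical.choose_spec (D.exists_specW_eq_iotaZp hW2 x),
      ← Classical.choose_spec (D.exists_specW_eq_iotaZp hW2 y)])
  map_zero' := iotaZp_injective (p := p) (by
    rw [← Classical.choose_spec (D.exists_specW_eq_iotaZp hW2 0), map_zero, map_zero])
  map_add' x y := iotaZp_injective (p := p) (by
    rw [← Classical.choose_spec (D.exists_specW_eq_iotaZp hW2 (x + y)), map_add, map_add,
      ← Classical.choose_spec (D.exists_specW_eq_iotaZp hW2 x),
      ← Classical.choose_spec (D.exists_specW_eq_iotaZp hW2 y)])

/-- `iotaZp ∘ specWZp = specW`. -/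
theorem iotaZp_specWZp (hW2 : D.WeightTwoRational) (x : I) : iotaZp p (D.specWZp hW2 x) = D.specW x :=
  (Classical.choose_spec (D.exists_specW_eq_iotaZp hW2 x)).symm

/-- `specWZp` has the same kernel as `specW`: `P_W`. -/
theorem ker_specWZp (hW2 : D.WeightTwoRational) : RingHom.ker (D.specWZp hW2) = RingHom.ker D.specW := by
  ext x
  rw [RingHom.mem_ker, RingHom.mem_ker, ← D.iotaZp_specWZp hW2 x]
  constructor
  · intro h
    rw [h, map_zero]
  · intro h
    exact iotaZp_injective (p := p) (by rw [h, map_zero])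

/-- `specWZp` retracts the constants `ℤ_p ⊆ Λ → 𝕀` (field (v) `specW_algebraMap`). -/
theorem specWZp_algebraMap_C (hW2 : D.WeightTwoRational) (a : ℤ_[p]) :
    D.specWZp hW2 (algebraMap (IwasawaAlgebra p) I (PowerSeries.C a)) = a :=
  iotaZp_injective (p := p) (by rw [D.iotaZp_specWZp hW2, D.specW_algebraMap_C, iotaZp_apply])

end Literature.NumberTheory.EllipticCurves.HidaFamilyGaloisRepDatum
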